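import Summits.HodgeConjecture.CorCM.Census.OcticWeilOrbitParts
import HarnessLib

/-!
# MIXED products over one octic CM field `F ⊇ k` with `2`-transitive quartic part: `E × B₁ × B₂ × B'` for TWO `(2,2)`-types
# `Φ_{I_0}, Φ_{I_1}` in general position and ONE `(1,3)`-type `Φ'_c` — the balanced weights of every product of copies are
# conjugate pairs, Weil `4`-sets of `B₁, B₂` and Weil SIXFOLD `6`-sets of `B' × E × E` (kernel census: the defect law)

COR-CM (cell `pub-hodgecm2`), seat b30 gen 20 (2026-08-22); count-neutral own lane OCTIC-WEIL-ORBIT, part MIXED (the NEXT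
SIZED ITEM after ORBIT: exact python `mixed_defect.py` / `mixed_census.py` in `HOME/pub-hodgecm2-b30/octic-orbit/`).
Bookkeeping definitions and theorems of a finite model; no named fact, no geometry, no `sorry`.  The 26-point model `Pt₃`,
its conjugation `cj₃`, the `A₄` tables `permTab`/`signTab` and the counting lemmas of `Census/OcticWeilOrbit` are reused BY
NAME; only the TYPE TABLE of slot `2` changes.

SETTING (to be formalised downstream).  `F ⊇ i(k)` octic CM, `τ : k → ℂ`, a frame `e : Hom(F, ℂ) ≃ Fin 4 × Bool`
(`(e s).2 = [s ∘ i = τ]`, `e s̄ = ((e s).1, ¬(e s).2)`); slot `m = 0, 1`: the `(2,2)`-types `Φ_{I_m}`, `I_m = {0, m+1}`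
(`s ∈ Φ_{I_m} ⟺ (e s).2 = [(e s).1 ∈ I_m]`); slot `2`: the `(1,3)`-type `Φ'_c = {e⁻¹(c, true)} ⊔ {e⁻¹(a, false) | a ≠ c}`
(ONE member over `τ`), `c < 4` a parameter (all four positions relative to the star `I_0, I_1` occur).  THE GALOIS INPUT:
every even permutation `permTab r` of the pairs is induced by an automorphism of `ℂ` fixing `τ` (`2`-transitivity; Dodson).

MODEL.  `inr (m, (a, s))` = the embedding of `F` with label `(a, s)` on a factor of slot `m`; `ρ_r⁻¹(type)` on slot `2` is
`{(a, s) | s = [permTab r a = c]}` (`signTabM c r 2 a`), on slots `0, 1` as in ORBIT.  `ModelBalancedM c v T`: the twelve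
equations `2 · #{x ∈ T | v x ∈ phiM c r} = |T|`.

RESULTS (kernel).
* `balancedM_iff_signed` — signed form `e + Σ_{m,a} ± d_{m,a} = 0` of the `r`-th equation;
* **`defectM_of_signed` / `exists_defectM_of_modelBalancedM`** — THE DEFECT LAW: `d_{m,a} = d_{m,0}` for all `m, a` AND
  `e = 2 · d_{2,0}` (solution space mod pairs = `ℤ W(B₁) ⊕ ℤ W(B₂) ⊕ ℤ S(B')`, `S(B') = 2[E₊] + Σ_a [(2, a, +)]` the Weil
  weight of the SIXFOLD `B' × E × E`; exact python: dimension `3` for all `c`, under the `τ`-fixing `A₄`-equations alone);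
* the parts (pairs, Weil parts of slots `0, 1`, sixfold parts), extraction and the induction principle follow in the
  sequel `Census/OcticWeilMixedParts.lean`.
NOT CLEAN (recorded, not claimed): three `(2,2)`-types plus a `(1,3)`-type (`3` extra rational solutions), and any two
`(1,3)`-types (the `E`-free balanced `8`-set `{(a,+)_{B'₁}, (a,−)_{B'₂}}` — a Weil class of the eightfold `B'₁ × B̄'₂` — is not a
disjoint union of parts).
[cite: Pohlmann1968, Thm 1] [cite: GaoUllmo2025, Thm 3.1] [cite: Dodson1984, §3.3.2 Theorem] [cite: MoonenZarhin1995Duke, Thm. 2.4]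

## References
* [Pohlmann1968] H. Pohlmann, Ann. of Math. 88 (1968), Thm 1.  [GaoUllmo2025] Z. Gao, E. Ullmo, J. Inst. Math. Jussieu 25
  (2025), Thm 3.1.  [Dodson1984] B. Dodson, Trans. AMS 283 (1984), §3.3.2.  [MoonenZarhin1995Duke] Duke Math. J. 77 (1995),
  Thm. 2.4.  [Gordon1999HodgeAVSurvey] B. B. Gordon, CRM Monogr. 10 (1999), 5.13 (ii), 9.2.2.  [Milne2020HodgeClassesAV]
  J. S. Milne, arXiv:2010.08857, 1.2 (a), Thm. 1.
-/

namespace Summit.HodgeConjecture.CorCM.Census.OcticWeilMixed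

open Finset
open Summit.HodgeConjecture.CorCM.Census.OcticWeilOrbit (Pt₃ cj₃ cj₃_inl cj₃_inr cj₃_facts permTab signTab IsPairPart₃
  IsWeil₃Part card_filter_mem_eq_sum₃ card_eq_sum₃ sum_pt₃ exists_weil₃Part_of_counts exists_pairPart₃_of_counts)

/-! ### The type table of the mixed model -/

/-- The slot-`2` table `sixTab c r a = [permTab r a = c]`: whether the label `(a, true)` of the `(1,3)`-factor lies in
`ρ_r⁻¹Φ'_c` (precomputed; `sixTab_eq`). [folklore] -/
def sixTab : Fin 4 → Fin 12 → Fin 4 → Bool :=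
  ![
    ![![true, false, false, false], ![true, false, false, false], ![true, false, false, false], ![false, true, false, false], ![false, false, true, false], ![false, false, false, true], ![false, true, false, false], ![false, false, false, true], ![false, false, true, false], ![false, true, false, false], ![false, false, true, false], ![false, false, false, true]],
    ![![false, true, false, false], ![false, false, false, true], ![false, false, true, false], ![true, false, false, false], ![true, false, false, false], ![true, false, false, false], ![false, false, true, false], ![false, true, false, false], ![false, false, false, true], ![false, false, false, true], ![false, true, false, false], ![false, false, true, false]],
    ![![false, false, true, false], ![false, true, false, false], ![false, false, false, true], ![false, false, false, true], ![false, true, false, false], ![false, false, true, false], ![true, false, false, false], ![true, false, false, false], ![true, false, false, false], ![false, false, true, false], ![false, false, false, true], ![false, true, false, false]],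
    ![![false, false, false, true], ![false, false, true, false], ![false, true, false, false], ![false, false, true, false], ![false, false, false, true], ![false, true, false, false], ![false, false, false, true], ![false, false, true, false], ![false, true, false, false], ![true, false, false, false], ![true, false, false, false], ![true, false, false, false]]]

/-- The table `sixTab` is `[permTab r a = c]`. [folklore] -/
theorem sixTab_eq : ∀ (c : Fin 4) (r : Fin 12) (a : Fin 4), sixTab c r a = decide (permTab r a = c) := by decide +kernel

/-- **The type table**: on slots `0, 1` the ORBIT table `signTab r m a = [permTab r a ∈ I_m]`; on slot `2` the `(1,3)`-type
`Φ'_c` read after `ρ_r`: `sixTab c r a = [permTab r a = c]`. [cite: GaoUllmo2025, Thm 3.1 (3.2)] -/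
def signTabM (c : Fin 4) (r : Fin 12) (m : Fin 3) (a : Fin 4) : Bool :=
  if m = 2 then sixTab c r a else signTab r m a

/-- Unfolding on slot `0`. [folklore] -/
theorem signTabM_zero (c : Fin 4) (r : Fin 12) (a : Fin 4) : signTabM c r 0 a = signTab r 0 a := rfl

/-- Unfolding on slot `1`. [folklore] -/
theorem signTabM_one (c : Fin 4) (r : Fin 12) (a : Fin 4) : signTabM c r 1 a = signTab r 1 a := rfl

/-- Unfolding on slot `2`: `signTabM c r 2 a = [permTab r a = c]`. [folklore] -/
theorem signTabM_two (c : Fin 4) (r : Fin 12) (a : Fin 4) : signTabM c r 2 a = decide (permTab r a = c) := by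
  rw [← sixTab_eq]; rfl

/-- `ρ_r⁻¹(type)` read in the model (Boolean form). [cite: GaoUllmo2025, Thm 3.1 (3.2)] -/
def inPhiM (c : Fin 4) (r : Fin 12) : Pt₃ → Bool
  | Sum.inl s => s
  | Sum.inr (m, (a, s)) => s == signTabM c r m a

/-- `ρ_r⁻¹(type)` as a finset of the model. [cite: GaoUllmo2025, Thm 3.1 (3.2)] -/
def phiM (c : Fin 4) (r : Fin 12) : Finset Pt₃ := univ.filter fun y => inPhiM c r y = true

/-- Membership, curve slot. [folklore] -/
theorem inl_mem_phiM (c : Fin 4) (r : Fin 12) (s : Bool) : Sum.inl s ∈ phiM c r ↔ s = true := by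
  simp [phiM, inPhiM]

/-- Membership, fourfold slots. [folklore] -/
theorem inr_mem_phiM (c : Fin 4) (r : Fin 12) (m : Fin 3) (a : Fin 4) (s : Bool) :
    Sum.inr (m, (a, s)) ∈ phiM c r ↔ s = signTabM c r m a := by
  simp [phiM, inPhiM]

/-- Each `phiM c r` is a CM type of the model (exactly one of `y`, `cj₃ y`; thirteen points). [folklore] -/
theorem phiM_isCMType : ∀ (c : Fin 4) (r : Fin 12), (∀ y : Pt₃, (y ∈ phiM c r ↔ cj₃ y ∉ phiM c r)) ∧ (phiM c r).card = 13 := by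
  unfold phiM inPhiM signTabM sixTab
  decide +kernel

/-- `phiM c r` as an explicit finset: `{inl true} ⊔ {inr (m, (a, signTabM c r m a))}`. [folklore] -/
theorem phiM_eq (c : Fin 4) (r : Fin 12) : phiM c r =
    insert (Sum.inl true) ((univ : Finset (Fin 3 × Fin 4)).image fun q => (Sum.inr (q.1, (q.2, signTabM c r q.1 q.2)) : Pt₃)) := by
  revert c r
  unfold phiM inPhiM
  decide +kernel

/-! ### Balanced configurations -/

variable {α : Type*}

/-- **Pohlmann's condition for a configuration** of a product of copies of `E, B₁, B₂, B'` under `A₄`-realisation: the twelve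
equations `2 · #{x ∈ T | v x ∈ ρ_r⁻¹(type)} = |T|`. [cite: GaoUllmo2025, Thm 3.1 eq. (3.2)] [cite: Dodson1984, §3.3.2 Theorem] -/
def ModelBalancedM (c : Fin 4) (v : α → Pt₃) (T : Finset α) : Prop :=
  ∀ r : Fin 12, 2 * (T.filter fun x => v x ∈ phiM c r).card = T.card

variable (c : Fin 4) (v : α → Pt₃)

/-- The empty configuration is balanced. [folklore] -/
theorem modelBalancedM_empty : ModelBalancedM c v (∅ : Finset α) := fun _ => by simp

variable {c v}

/-- **Removing a balanced part keeps the balance.** [folklore] -/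
theorem ModelBalancedM.sdiff [DecidableEq α] {T G : Finset α} (hT : ModelBalancedM c v T) (hG : ModelBalancedM c v G)
    (hGT : G ⊆ T) : ModelBalancedM c v (T \ G) := by
  intro r
  have key : ∀ (Q : α → Prop) [DecidablePred Q],
      ((T \ G).filter Q).card = (T.filter Q).card - (G.filter Q).card := by
    intro Q _
    rw [← Finset.card_sdiff_of_subset (Finset.filter_subset_filter Q hGT)]
    congr 1
    ext x
    simp only [Finset.mem_filter, Finset.mem_sdiff]
    tauto
  have h1 := hT r
  have h2 := hG r
  have h3 := Finset.card_sdiff_of_subset hGT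
  have h4 : (G.filter fun x => v x ∈ phiM c r).card ≤ (T.filter fun x => v x ∈ phiM c r).card :=
    Finset.card_le_card (Finset.filter_subset_filter _ hGT)
  rw [key, h3]
  omega

/-! ### The signed form and the defect law -/

/-- The sum over `phiM c r`, expanded. [folklore] -/
theorem sum_phiM (c : Fin 4) (r : Fin 12) (N : Pt₃ → ℕ) :
    ∑ y ∈ phiM c r, N y = N (Sum.inl true) + ∑ m : Fin 3, ∑ a : Fin 4, N (Sum.inr (m, (a, signTabM c r m a))) := by
  rw [phiM_eq c r]
  have hinj : Function.Injective fun q : Fin 3 × Fin 4 => (Sum.inr (q.1, (q.2, signTabM c r q.1 q.2)) : Pt₃) := by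
    rintro ⟨m, a⟩ ⟨m', a'⟩ h
    simp only [Sum.inr.injEq, Prod.mk.injEq] at h
    obtain ⟨rfl, rfl, -⟩ := h
    rfl
  have h1 : Sum.inl true ∉ (univ : Finset (Fin 3 × Fin 4)).image
      fun q => (Sum.inr (q.1, (q.2, signTabM c r q.1 q.2)) : Pt₃) := by simp
  rw [Finset.sum_insert h1, Finset.sum_image fun q _ q' _ h => hinj h, Fintype.sum_prod_type]

/-- **The signed form of the `r`-th balance equation**: `2 Σ_{y ∈ phiM c r} N y = Σ_y N y` iff
`(N t − N f) + Σ_{m,a} ± (N(m,a,t) − N(m,a,f)) = 0`, the sign being `+` iff `signTabM c r m a`. [cite: GaoUllmo2025, Thm 3.1] -/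
theorem balancedM_iff_signed (c : Fin 4) (r : Fin 12) (N : Pt₃ → ℕ) :
    2 * ∑ y ∈ phiM c r, N y = ∑ y : Pt₃, N y ↔
      ((N (Sum.inl true) : ℤ) - N (Sum.inl false)) + ∑ m : Fin 3, ∑ a : Fin 4,
        (if signTabM c r m a then ((N (Sum.inr (m, (a, true))) : ℤ) - N (Sum.inr (m, (a, false))))
          else -(((N (Sum.inr (m, (a, true))) : ℤ) - N (Sum.inr (m, (a, false)))))) = 0 := by
  rw [sum_phiM, sum_pt₃]
  have key : ∀ m a, (2 * (N (Sum.inr (m, (a, signTabM c r m a))) : ℤ)) =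
      ((N (Sum.inr (m, (a, true))) : ℤ) + N (Sum.inr (m, (a, false)))) +
        (if signTabM c r m a then ((N (Sum.inr (m, (a, true))) : ℤ) - N (Sum.inr (m, (a, false))))
          else -(((N (Sum.inr (m, (a, true))) : ℤ) - N (Sum.inr (m, (a, false)))))) := by
    intro m a
    cases signTabM c r m a <;> simp <;> ring
  have hsum : (2 * (∑ m : Fin 3, ∑ a : Fin 4, N (Sum.inr (m, (a, signTabM c r m a)))) : ℤ) =
      (∑ m : Fin 3, ∑ a : Fin 4, (((N (Sum.inr (m, (a, true))) : ℤ) + N (Sum.inr (m, (a, false)))))) +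
        ∑ m : Fin 3, ∑ a : Fin 4,
          (if signTabM c r m a then ((N (Sum.inr (m, (a, true))) : ℤ) - N (Sum.inr (m, (a, false))))
            else -(((N (Sum.inr (m, (a, true))) : ℤ) - N (Sum.inr (m, (a, false)))))) := by
    push_cast
    rw [Finset.mul_sum, ← Finset.sum_add_distrib]
    refine Finset.sum_congr rfl fun m _ => ?_
    rw [Finset.mul_sum, ← Finset.sum_add_distrib]
    refine Finset.sum_congr rfl fun a _ => ?_
    exact key m a
  constructor
  · intro h
    have hz : (2 : ℤ) * ((N (Sum.inl true) : ℤ) + ((∑ m : Fin 3, ∑ a : Fin 4, N (Sum.inr (m, (a, signTabM c r m a))) : ℕ) : ℤ)) =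
        (N (Sum.inl true) : ℤ) + N (Sum.inl false) +
          ((∑ m : Fin 3, ∑ a : Fin 4, (N (Sum.inr (m, (a, true))) + N (Sum.inr (m, (a, false)))) : ℕ) : ℤ) := by
      exact_mod_cast h
    push_cast at hz hsum
    linarith
  · intro h
    have hz : (2 : ℤ) * ((N (Sum.inl true) : ℤ) + ((∑ m : Fin 3, ∑ a : Fin 4, N (Sum.inr (m, (a, signTabM c r m a))) : ℕ) : ℤ)) =
        (N (Sum.inl true) : ℤ) + N (Sum.inl false) +
          ((∑ m : Fin 3, ∑ a : Fin 4, (N (Sum.inr (m, (a, true))) + N (Sum.inr (m, (a, false)))) : ℕ) : ℤ) := by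
      push_cast at hsum ⊢
      linarith
    exact_mod_cast hz

/-- The defect law at position `c = 0`, slot `0`: `d_{0,a}` is constant in `a`. [cite: Dodson1984, §3.3.2 Theorem] -/
private theorem defectM_c0_m0 (e : ℤ) (d : Fin 3 → Fin 4 → ℤ)
    (h : ∀ r : Fin 12, e + ∑ m : Fin 3, ∑ a : Fin 4, (if signTabM 0 r m a then d m a else -d m a) = 0) (a : Fin 4) :
    d 0 a = d 0 0 := by
  have h0 := h 0; have h1 := h 1; have h2 := h 2; have h3 := h 3; have h4 := h 4; have h5 := h 5
  have h6 := h 6; have h7 := h 7; have h8 := h 8; have h9 := h 9; have h10 := h 10; have h11 := h 11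
  simp [Fin.sum_univ_three, Fin.sum_univ_four, signTabM, signTab, sixTab] at h0 h1 h2 h3 h4 h5 h6 h7 h8 h9 h10 h11
  fin_cases a <;> simp <;> omega

/-- The defect law at position `c = 0`, slot `1`: `d_{1,a}` is constant in `a`. [cite: Dodson1984, §3.3.2 Theorem] -/
private theorem defectM_c0_m1 (e : ℤ) (d : Fin 3 → Fin 4 → ℤ)
    (h : ∀ r : Fin 12, e + ∑ m : Fin 3, ∑ a : Fin 4, (if signTabM 0 r m a then d m a else -d m a) = 0) (a : Fin 4) :
    d 1 a = d 1 0 := by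
  have h0 := h 0; have h1 := h 1; have h2 := h 2; have h3 := h 3; have h4 := h 4; have h5 := h 5
  have h6 := h 6; have h7 := h 7; have h8 := h 8; have h9 := h 9; have h10 := h 10; have h11 := h 11
  simp [Fin.sum_univ_three, Fin.sum_univ_four, signTabM, signTab, sixTab] at h0 h1 h2 h3 h4 h5 h6 h7 h8 h9 h10 h11
  fin_cases a <;> simp <;> omega

/-- The defect law at position `c = 0`, slot `2`: `d_{2,a}` is constant in `a`. [cite: Dodson1984, §3.3.2 Theorem] -/
private theorem defectM_c0_m2 (e : ℤ) (d : Fin 3 → Fin 4 → ℤ)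
    (h : ∀ r : Fin 12, e + ∑ m : Fin 3, ∑ a : Fin 4, (if signTabM 0 r m a then d m a else -d m a) = 0) (a : Fin 4) :
    d 2 a = d 2 0 := by
  have h0 := h 0; have h1 := h 1; have h2 := h 2; have h3 := h 3; have h4 := h 4; have h5 := h 5
  have h6 := h 6; have h7 := h 7; have h8 := h 8; have h9 := h 9; have h10 := h 10; have h11 := h 11
  simp [Fin.sum_univ_three, Fin.sum_univ_four, signTabM, signTab, sixTab] at h0 h1 h2 h3 h4 h5 h6 h7 h8 h9 h10 h11
  fin_cases a <;> simp <;> omega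

/-- The defect law at position `c = 0`, curve: `e = 2 d_{2,0}`. [cite: Dodson1984, §3.3.2 Theorem] -/
private theorem defectM_c0_e (e : ℤ) (d : Fin 3 → Fin 4 → ℤ)
    (h : ∀ r : Fin 12, e + ∑ m : Fin 3, ∑ a : Fin 4, (if signTabM 0 r m a then d m a else -d m a) = 0) :
    e = 2 * d 2 0 := by
  have h0 := h 0; have h1 := h 1; have h2 := h 2; have h3 := h 3; have h4 := h 4; have h5 := h 5
  have h6 := h 6; have h7 := h 7; have h8 := h 8; have h9 := h 9; have h10 := h 10; have h11 := h 11
  simp [Fin.sum_univ_three, Fin.sum_univ_four, signTabM, signTab, sixTab] at h0 h1 h2 h3 h4 h5 h6 h7 h8 h9 h10 h11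
  omega

/-- The defect law at position `c = 1`, slot `0`: `d_{0,a}` is constant in `a`. [cite: Dodson1984, §3.3.2 Theorem] -/
private theorem defectM_c1_m0 (e : ℤ) (d : Fin 3 → Fin 4 → ℤ)
    (h : ∀ r : Fin 12, e + ∑ m : Fin 3, ∑ a : Fin 4, (if signTabM 1 r m a then d m a else -d m a) = 0) (a : Fin 4) :
    d 0 a = d 0 0 := by
  have h0 := h 0; have h1 := h 1; have h2 := h 2; have h3 := h 3; have h4 := h 4; have h5 := h 5
  have h6 := h 6; have h7 := h 7; have h8 := h 8; have h9 := h 9; have h10 := h 10; have h11 := h 11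
  simp [Fin.sum_univ_three, Fin.sum_univ_four, signTabM, signTab, sixTab] at h0 h1 h2 h3 h4 h5 h6 h7 h8 h9 h10 h11
  fin_cases a <;> simp <;> omega

/-- The defect law at position `c = 1`, slot `1`: `d_{1,a}` is constant in `a`. [cite: Dodson1984, §3.3.2 Theorem] -/
private theorem defectM_c1_m1 (e : ℤ) (d : Fin 3 → Fin 4 → ℤ)
    (h : ∀ r : Fin 12, e + ∑ m : Fin 3, ∑ a : Fin 4, (if signTabM 1 r m a then d m a else -d m a) = 0) (a : Fin 4) :
    d 1 a = d 1 0 := by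
  have h0 := h 0; have h1 := h 1; have h2 := h 2; have h3 := h 3; have h4 := h 4; have h5 := h 5
  have h6 := h 6; have h7 := h 7; have h8 := h 8; have h9 := h 9; have h10 := h 10; have h11 := h 11
  simp [Fin.sum_univ_three, Fin.sum_univ_four, signTabM, signTab, sixTab] at h0 h1 h2 h3 h4 h5 h6 h7 h8 h9 h10 h11
  fin_cases a <;> simp <;> omega

/-- The defect law at position `c = 1`, slot `2`: `d_{2,a}` is constant in `a`. [cite: Dodson1984, §3.3.2 Theorem] -/
private theorem defectM_c1_m2 (e : ℤ) (d : Fin 3 → Fin 4 → ℤ)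
    (h : ∀ r : Fin 12, e + ∑ m : Fin 3, ∑ a : Fin 4, (if signTabM 1 r m a then d m a else -d m a) = 0) (a : Fin 4) :
    d 2 a = d 2 0 := by
  have h0 := h 0; have h1 := h 1; have h2 := h 2; have h3 := h 3; have h4 := h 4; have h5 := h 5
  have h6 := h 6; have h7 := h 7; have h8 := h 8; have h9 := h 9; have h10 := h 10; have h11 := h 11
  simp [Fin.sum_univ_three, Fin.sum_univ_four, signTabM, signTab, sixTab] at h0 h1 h2 h3 h4 h5 h6 h7 h8 h9 h10 h11
  fin_cases a <;> simp <;> omega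

/-- The defect law at position `c = 1`, curve: `e = 2 d_{2,0}`. [cite: Dodson1984, §3.3.2 Theorem] -/
private theorem defectM_c1_e (e : ℤ) (d : Fin 3 → Fin 4 → ℤ)
    (h : ∀ r : Fin 12, e + ∑ m : Fin 3, ∑ a : Fin 4, (if signTabM 1 r m a then d m a else -d m a) = 0) :
    e = 2 * d 2 0 := by
  have h0 := h 0; have h1 := h 1; have h2 := h 2; have h3 := h 3; have h4 := h 4; have h5 := h 5
  have h6 := h 6; have h7 := h 7; have h8 := h 8; have h9 := h 9; have h10 := h 10; have h11 := h 11
  simp [Fin.sum_univ_three, Fin.sum_univ_four, signTabM, signTab, sixTab] at h0 h1 h2 h3 h4 h5 h6 h7 h8 h9 h10 h11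
  omega

/-- The defect law at position `c = 2`, slot `0`: `d_{0,a}` is constant in `a`. [cite: Dodson1984, §3.3.2 Theorem] -/
private theorem defectM_c2_m0 (e : ℤ) (d : Fin 3 → Fin 4 → ℤ)
    (h : ∀ r : Fin 12, e + ∑ m : Fin 3, ∑ a : Fin 4, (if signTabM 2 r m a then d m a else -d m a) = 0) (a : Fin 4) :
    d 0 a = d 0 0 := by
  have h0 := h 0; have h1 := h 1; have h2 := h 2; have h3 := h 3; have h4 := h 4; have h5 := h 5
  have h6 := h 6; have h7 := h 7; have h8 := h 8; have h9 := h 9; have h10 := h 10; have h11 := h 11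
  simp [Fin.sum_univ_three, Fin.sum_univ_four, signTabM, signTab, sixTab] at h0 h1 h2 h3 h4 h5 h6 h7 h8 h9 h10 h11
  fin_cases a <;> simp <;> omega

/-- The defect law at position `c = 2`, slot `1`: `d_{1,a}` is constant in `a`. [cite: Dodson1984, §3.3.2 Theorem] -/
private theorem defectM_c2_m1 (e : ℤ) (d : Fin 3 → Fin 4 → ℤ)
    (h : ∀ r : Fin 12, e + ∑ m : Fin 3, ∑ a : Fin 4, (if signTabM 2 r m a then d m a else -d m a) = 0) (a : Fin 4) :
    d 1 a = d 1 0 := by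
  have h0 := h 0; have h1 := h 1; have h2 := h 2; have h3 := h 3; have h4 := h 4; have h5 := h 5
  have h6 := h 6; have h7 := h 7; have h8 := h 8; have h9 := h 9; have h10 := h 10; have h11 := h 11
  simp [Fin.sum_univ_three, Fin.sum_univ_four, signTabM, signTab, sixTab] at h0 h1 h2 h3 h4 h5 h6 h7 h8 h9 h10 h11
  fin_cases a <;> simp <;> omega

/-- The defect law at position `c = 2`, slot `2`: `d_{2,a}` is constant in `a`. [cite: Dodson1984, §3.3.2 Theorem] -/
private theorem defectM_c2_m2 (e : ℤ) (d : Fin 3 → Fin 4 → ℤ)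
    (h : ∀ r : Fin 12, e + ∑ m : Fin 3, ∑ a : Fin 4, (if signTabM 2 r m a then d m a else -d m a) = 0) (a : Fin 4) :
    d 2 a = d 2 0 := by
  have h0 := h 0; have h1 := h 1; have h2 := h 2; have h3 := h 3; have h4 := h 4; have h5 := h 5
  have h6 := h 6; have h7 := h 7; have h8 := h 8; have h9 := h 9; have h10 := h 10; have h11 := h 11
  simp [Fin.sum_univ_three, Fin.sum_univ_four, signTabM, signTab, sixTab] at h0 h1 h2 h3 h4 h5 h6 h7 h8 h9 h10 h11
  fin_cases a <;> simp <;> omega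

/-- The defect law at position `c = 2`, curve: `e = 2 d_{2,0}`. [cite: Dodson1984, §3.3.2 Theorem] -/
private theorem defectM_c2_e (e : ℤ) (d : Fin 3 → Fin 4 → ℤ)
    (h : ∀ r : Fin 12, e + ∑ m : Fin 3, ∑ a : Fin 4, (if signTabM 2 r m a then d m a else -d m a) = 0) :
    e = 2 * d 2 0 := by
  have h0 := h 0; have h1 := h 1; have h2 := h 2; have h3 := h 3; have h4 := h 4; have h5 := h 5
  have h6 := h 6; have h7 := h 7; have h8 := h 8; have h9 := h 9; have h10 := h 10; have h11 := h 11
  simp [Fin.sum_univ_three, Fin.sum_univ_four, signTabM, signTab, sixTab] at h0 h1 h2 h3 h4 h5 h6 h7 h8 h9 h10 h11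
  omega

/-- The defect law at position `c = 3`, slot `0`: `d_{0,a}` is constant in `a`. [cite: Dodson1984, §3.3.2 Theorem] -/
private theorem defectM_c3_m0 (e : ℤ) (d : Fin 3 → Fin 4 → ℤ)
    (h : ∀ r : Fin 12, e + ∑ m : Fin 3, ∑ a : Fin 4, (if signTabM 3 r m a then d m a else -d m a) = 0) (a : Fin 4) :
    d 0 a = d 0 0 := by
  have h0 := h 0; have h1 := h 1; have h2 := h 2; have h3 := h 3; have h4 := h 4; have h5 := h 5
  have h6 := h 6; have h7 := h 7; have h8 := h 8; have h9 := h 9; have h10 := h 10; have h11 := h 11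
  simp [Fin.sum_univ_three, Fin.sum_univ_four, signTabM, signTab, sixTab] at h0 h1 h2 h3 h4 h5 h6 h7 h8 h9 h10 h11
  fin_cases a <;> simp <;> omega

/-- The defect law at position `c = 3`, slot `1`: `d_{1,a}` is constant in `a`. [cite: Dodson1984, §3.3.2 Theorem] -/
private theorem defectM_c3_m1 (e : ℤ) (d : Fin 3 → Fin 4 → ℤ)
    (h : ∀ r : Fin 12, e + ∑ m : Fin 3, ∑ a : Fin 4, (if signTabM 3 r m a then d m a else -d m a) = 0) (a : Fin 4) :
    d 1 a = d 1 0 := by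
  have h0 := h 0; have h1 := h 1; have h2 := h 2; have h3 := h 3; have h4 := h 4; have h5 := h 5
  have h6 := h 6; have h7 := h 7; have h8 := h 8; have h9 := h 9; have h10 := h 10; have h11 := h 11
  simp [Fin.sum_univ_three, Fin.sum_univ_four, signTabM, signTab, sixTab] at h0 h1 h2 h3 h4 h5 h6 h7 h8 h9 h10 h11
  fin_cases a <;> simp <;> omega

/-- The defect law at position `c = 3`, slot `2`: `d_{2,a}` is constant in `a`. [cite: Dodson1984, §3.3.2 Theorem] -/
private theorem defectM_c3_m2 (e : ℤ) (d : Fin 3 → Fin 4 → ℤ)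
    (h : ∀ r : Fin 12, e + ∑ m : Fin 3, ∑ a : Fin 4, (if signTabM 3 r m a then d m a else -d m a) = 0) (a : Fin 4) :
    d 2 a = d 2 0 := by
  have h0 := h 0; have h1 := h 1; have h2 := h 2; have h3 := h 3; have h4 := h 4; have h5 := h 5
  have h6 := h 6; have h7 := h 7; have h8 := h 8; have h9 := h 9; have h10 := h 10; have h11 := h 11
  simp [Fin.sum_univ_three, Fin.sum_univ_four, signTabM, signTab, sixTab] at h0 h1 h2 h3 h4 h5 h6 h7 h8 h9 h10 h11
  fin_cases a <;> simp <;> omega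

/-- The defect law at position `c = 3`, curve: `e = 2 d_{2,0}`. [cite: Dodson1984, §3.3.2 Theorem] -/
private theorem defectM_c3_e (e : ℤ) (d : Fin 3 → Fin 4 → ℤ)
    (h : ∀ r : Fin 12, e + ∑ m : Fin 3, ∑ a : Fin 4, (if signTabM 3 r m a then d m a else -d m a) = 0) :
    e = 2 * d 2 0 := by
  have h0 := h 0; have h1 := h 1; have h2 := h 2; have h3 := h 3; have h4 := h 4; have h5 := h 5
  have h6 := h 6; have h7 := h 7; have h8 := h 8; have h9 := h 9; have h10 := h 10; have h11 := h 11
  simp [Fin.sum_univ_three, Fin.sum_univ_four, signTabM, signTab, sixTab] at h0 h1 h2 h3 h4 h5 h6 h7 h8 h9 h10 h11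
  omega

/-- **THE DEFECT LAW, linear-algebra core**: the twelve signed `A₄`-equations of the mixed model force each `d_m` constant in
`a` AND `e = 2 d_{2,0}` (solution space of dimension `3` in the `13` unknowns, for every position `c` of the `(1,3)`-type).
[cite: Dodson1984, §3.3.2 Theorem] [cite: MoonenZarhin1995Duke, Thm. 2.4] -/
theorem defectM_of_signed (c : Fin 4) (e : ℤ) (d : Fin 3 → Fin 4 → ℤ)
    (h : ∀ r : Fin 12, e + ∑ m : Fin 3, ∑ a : Fin 4, (if signTabM c r m a then d m a else -d m a) = 0) :
    (∀ (m : Fin 3) (a : Fin 4), d m a = d m 0) ∧ e = 2 * d 2 0 := by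
  fin_cases c
  · refine ⟨fun m => ?_, defectM_c0_e e d h⟩
    fin_cases m
    exacts [defectM_c0_m0 e d h, defectM_c0_m1 e d h, defectM_c0_m2 e d h]
  · refine ⟨fun m => ?_, defectM_c1_e e d h⟩
    fin_cases m
    exacts [defectM_c1_m0 e d h, defectM_c1_m1 e d h, defectM_c1_m2 e d h]
  · refine ⟨fun m => ?_, defectM_c2_e e d h⟩
    fin_cases m
    exacts [defectM_c2_m0 e d h, defectM_c2_m1 e d h, defectM_c2_m2 e d h]
  · refine ⟨fun m => ?_, defectM_c3_e e d h⟩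
    fin_cases m
    exacts [defectM_c3_m0 e d h, defectM_c3_m1 e d h, defectM_c3_m2 e d h]

/-- **THE DEFECT LAW of a balanced configuration**: for each slot `m` ONE integer `t_m` with `N(m,a,true) − N(m,a,false) = t_m`
for all `a`, and on the curve `N(inl true) − N(inl false) = 2 t_2`. [cite: GaoUllmo2025, Thm 3.1] [cite: Dodson1984, §3.3.2 Theorem] -/
theorem exists_defectM_of_modelBalancedM {T : Finset α} (hT : ModelBalancedM c v T) :
    ∃ t : Fin 3 → ℤ, (∀ (m : Fin 3) (a : Fin 4), ((T.filter fun x => v x = Sum.inr (m, (a, true))).card : ℤ) -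
        (T.filter fun x => v x = Sum.inr (m, (a, false))).card = t m) ∧
      ((T.filter fun x => v x = Sum.inl true).card : ℤ) - (T.filter fun x => v x = Sum.inl false).card = 2 * t 2 := by
  have hs := fun r => (balancedM_iff_signed c r (fun y => (T.filter fun x => v x = y).card)).1 (by
    have h := hT r
    rw [card_filter_mem_eq_sum₃, card_eq_sum₃ v T] at h
    exact h)
  obtain ⟨hd, he⟩ := defectM_of_signed c _
    (fun m a => (((T.filter fun x => v x = Sum.inr (m, (a, true))).card : ℕ) : ℤ) -
      (T.filter fun x => v x = Sum.inr (m, (a, false))).card) hs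
  exact ⟨fun m => ((T.filter fun x => v x = Sum.inr (m, ((0 : Fin 4), true))).card : ℤ) -
      (T.filter fun x => v x = Sum.inr (m, ((0 : Fin 4), false))).card, fun m a => hd m a, he⟩

end Summit.HodgeConjecture.CorCM.Census.OcticWeilMixed
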